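import Mathlib
import HarnessLib
import Summits.NavierStokesRegularity.NavierStokesRegularity.Theses.AdiabaticEddy
import Literature.Analysis.FluidPDE.AxisymmetricEuler
import Literature.Analysis.FluidPDE.Superhelicity

/-!
# FrozenEddyCollapse — ideator 2 sketch (crux `stmt-NavierStokesRegularity-1430`, round 1)

Statements only (`def … : Prop`, no `sorry`) over existing declarations, for the one crux idea
card filed by `planner-cruxidea-stmt-NavierStokesRegularity-1430-2-0` and for the obstruction
statements recorded in the unit's Barrier notes (`NegativeNotes-ideator2.md` in the crux dir):

* `IsSteadyEddy`, `SolvesCorrectorWithStress` — sugar for the route's steady-Euler block and its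
  corrector equation (★) (`AdiabaticEddy.CorrectorSolvable`) forced by an extra stress divergence;
* card `realizable-stress-closure`: `StressClosedCorrectorSolvable` (first lemma: (★) closed by a
  REALIZABLE Reynolds stress `S = Σₖ wₖ ⊗ wₖ` of divergence-free fluctuation snapshots with strictly
  positive production) and `StressedSwirlMomentLaw` (the swirl-moment identities every such closure
  must satisfy on an axisymmetric profile — the quantitative form of "countergradient eddy torque at
  the swirl maximum is necessary");
* Barrier notes: `CorrectorForcesNonpositive` (BN1: the stress-free case `K = 0` forces
  `a + b ≤ 0` on axisymmetric swirling profiles, killing `CorrectorSolvable` on the known supply),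
  `NoAxisymmetricFrozenEddyCollapse` (BN2: a globally axisymmetric witness is impossible — swirl
  maximum principle vs `A·L → ∞`).
-/

noncomputable section

namespace Summit.NavierStokesRegularity.NavierStokesRegularity.Cruxes.FrozenEddyCollapse.Ideator2

open Set Filter Topology MeasureTheory WithLp
open Literature.Analysis.FluidPDE Literature.Analysis.FluidPDE.VectorCalculus
open Summit.NavierStokesRegularity.NavierStokesRegularity.Theses.AdiabaticEddy

local notation "ℝ³" => EuclideanSpace ℝ (Fin 3)

/-! ### Shared sugar -/

/-- The route's "nonzero smooth compactly supported steady Euler flow" block. -/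
def IsSteadyEddy (U : ℝ³ → ℝ³) (P : ℝ³ → ℝ) : Prop :=
  ContDiff ℝ (⊤ : ℕ∞) U ∧ ContDiff ℝ (⊤ : ℕ∞) P ∧ HasCompactSupport U ∧ U ≠ 0 ∧ IsDivFree U ∧
    ∀ x, convect U U x + gradient P x = 0

/-- The corrector equation (★) of `AdiabaticEddy.CorrectorSolvable` with an additional
prescribed force `−F` on the right (for a Reynolds-stress closure `F = div S`):
`U·∇W + W·∇U + ∇q = ΔU − aU + b(y·∇)U + (c·∇)U − F`. For `F = 0` this is literally (★)
(`a = (L²/ν)Ȧ/A`, `b = LL̇/ν`; collapse is `b < 0`, Type II is `a + b > 0`). -/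
def SolvesCorrectorWithStress (U W F : ℝ³ → ℝ³) (q : ℝ³ → ℝ) (a b : ℝ) (c : ℝ³) : Prop :=
  ∀ y, convect U W y + convect W U y + gradient q y =
    Laplacian.laplacian U y - a • U y + b • (fderiv ℝ U y) y + (fderiv ℝ U y) c - F y

/-- The rotation generator about the `x 2`-axis, `J y = e₂ × y = (−y₁, y₀, 0)` (`= ρ e_θ`, smooth,
no division by `ρ`); `swirl U y = ⟪U y, J y⟫`. -/
def rotGen (y : ℝ³) : ℝ³ := toLp 2 ![-(y 1), y 0, 0]

/-! ### Card `realizable-stress-closure` -/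

/-- **First lemma of card `realizable-stress-closure` (mean-field rung one).** Some nonzero smooth
compactly supported steady Euler flow `U` admits a REALIZABLE stress closure of the collapsing,
Type-II corrector equation: finitely many smooth divergence-free fluctuation snapshots `wₖ`
supported in the eddy (Reynolds stress `S = Σₖ wₖ ⊗ wₖ`, automatically positive semidefinite,
`div S = Σₖ wₖ·∇wₖ`), with STRICTLY POSITIVE PRODUCTION `Σₖ ∫ ⟪U, wₖ·∇wₖ⟫ > 0` (the stress force
does net negative work on the mean: the fluctuations are fed by the mean shear and are therefore
dissipative — conservative Kelvin waves have zero production and are idle by non-acceleration),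
and a smooth divergence-free corrector `W` solving (★) forced by `−div S` with `b < 0 < a + b`.
For `K = 0` this is `CorrectorSolvable`, false on every axisymmetric swirling `U`
(`CorrectorForcesNonpositive`). -/
def StressClosedCorrectorSolvable : Prop :=
  ∃ (U : ℝ³ → ℝ³) (P : ℝ³ → ℝ), IsSteadyEddy U P ∧
    ∃ (K : ℕ) (w : Fin K → ℝ³ → ℝ³),
      (∀ k, ContDiff ℝ (⊤ : ℕ∞) (w k) ∧ IsDivFree (w k) ∧ HasCompactSupport (w k) ∧
        tsupport (w k) ⊆ tsupport U) ∧
      0 < ∑ k, ∫ y, inner ℝ (U y) (convect (w k) (w k) y) ∧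
      ∃ (W : ℝ³ → ℝ³) (q : ℝ³ → ℝ) (a b : ℝ) (c : ℝ³),
        ContDiff ℝ (⊤ : ℕ∞) W ∧ ContDiff ℝ (⊤ : ℕ∞) q ∧ IsDivFree W ∧ b < 0 ∧ 0 < a + b ∧
        SolvesCorrectorWithStress U W (fun y => ∑ k, convect (w k) (w k) y) q a b c

/-- **Swirl-moment laws of a stress-closed corrector (card `realizable-stress-closure`, necessary
condition; provable now by one integration by parts).** On an AXISYMMETRIC profile the fields
`Z_p = |Γ|^{p−2} Γ · J` (`Γ = swirl U`, `p ≥ 2`) lie in the cokernel of the linearised steady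
Euler operator, so pairing the stress-closed (★) with them gives, for every `p ≥ 2`,
`Σₖ ∫ ⟪wₖ, D Z_p · wₖ⟫ = (p − 1) ∫ |Γ|^{p−2} |∇Γ|² + (a + b + 3b/p) ∫ |Γ|^p`.
The left side is the eddy torque moment `∫ ρ (p−1)|Γ|^{p−2} (S e_θ)·∇Γ`; with `b < 0 < a + b`
the right side is eventually `> 0` (both of its terms scale like `p^{-3/2}` at a nondegenerate
maximum), so as `p → ∞` the closure needs COUNTERGRADIENT angular-momentum flux
`|(S e_θ)_{mer}| ≳ |∇Γ|`, `(S e_θ)·∇Γ > 0`, near the torus of maximal `|Γ|`, while realizability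
(`S ⪰ 0`) ties that flux to fluctuation energy which positive total production must supply.
This `p`-family is the constraint generator of the card's feasibility problem. -/
def StressedSwirlMomentLaw : Prop :=
  ∀ (U W : ℝ³ → ℝ³) (P q : ℝ³ → ℝ) (a b : ℝ) (c : ℝ³) (K : ℕ) (w : Fin K → ℝ³ → ℝ³) (p : ℝ),
    2 ≤ p → IsSteadyEddy U P → IsAxisymmetric U →
    (∀ k, ContDiff ℝ (⊤ : ℕ∞) (w k) ∧ IsDivFree (w k) ∧ HasCompactSupport (w k)) →
    ContDiff ℝ (⊤ : ℕ∞) W → IsDivFree W → (∀ R : ℝ, ∃ C, ∀ y, R ≤ ‖y‖ → ‖W y‖ ≤ C) →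
    SolvesCorrectorWithStress U W (fun y => ∑ k, convect (w k) (w k) y) q a b c →
    (∑ k, ∫ y, inner ℝ (w k y)
        (fderiv ℝ (fun z => (|swirl U z| ^ (p - 2) * swirl U z) • rotGen z) y (w k y))) =
      (p - 1) * (∫ y, |swirl U y| ^ (p - 2) * ‖gradient (swirl U) y‖ ^ 2) +
        (a + b + 3 * b / p) * ∫ y, |swirl U y| ^ p

/-! ### Barrier notes (obstruction statements, for the disprover / cruxes 1429 and 1431) -/

/-- **Swirl-Casimir veto (Barrier note BN1).** For an AXISYMMETRIC steady eddy WITH swirl, every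
bounded solution of the stress-free corrector equation (★) has `a + b ≤ 0` — so
`CorrectorSolvable`'s `b < 0 < a + b` is impossible on axisymmetric profiles (and, the argument being
blob-local, on finite disjoint unions of them, i.e. on the whole Gavrilov/Constantin–La–Vicol
supply). Proof sketch: the `K = 0` case of `StressedSwirlMomentLaw` reads
`0 = (p−1)∫|Γ|^{p−2}|∇Γ|² + (a + b + 3b/p)∫|Γ|^p`, hence `a + b + 3b/p ≤ 0` for all `p ≥ 2`. -/
def CorrectorForcesNonpositive : Prop :=
  ∀ (U W : ℝ³ → ℝ³) (P q : ℝ³ → ℝ) (a b : ℝ) (c : ℝ³),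
    IsSteadyEddy U P → IsAxisymmetric U → ¬ HasNoSwirl U →
    ContDiff ℝ (⊤ : ℕ∞) W → IsDivFree W → (∀ R : ℝ, ∃ C, ∀ y, R ≤ ‖y‖ → ‖W y‖ ≤ C) →
    SolvesCorrectorWithStress U W 0 q a b c → a + b ≤ 0

/-- **No globally axisymmetric frozen-eddy collapse (Barrier note BN2).** If the solution itself
is axisymmetric (about the `x 2`-axis) and the centre path stays on the axis, the crux's
convergence clause forces the frozen profile to be swirl-free: the swirl `Γ = ρ u_θ` obeys the
maximum principle (in-tree `abs_swirl_le_of_classical`) while the clause gives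
`Γ ≈ A·L·(ρ U_θ)(y)` with `A·L = (T−t)^{1/2−α}·ℓ√ν → ∞`. -/
def NoAxisymmetricFrozenEddyCollapse : Prop :=
  ∀ ν : ℝ, 0 < ν → ∀ T : ℝ, 0 < T → ∀ (u : ℝ → ℝ³ → ℝ³) (p : ℝ → ℝ³ → ℝ),
    IsClassicalNSSolutionOn (Set.Ico 0 T) ν 0 u p → IsLerayHopfOn T ν 0 (u 0) u →
    HasRapidSpatialDecay (u 0) → (∀ t ∈ Set.Ico 0 T, IsAxisymmetric (u t)) →
    ∀ (U : ℝ³ → ℝ³), ContDiff ℝ (⊤ : ℕ∞) U →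
    ∀ α ∈ Set.Ioo (1 / 2 : ℝ) (3 / 4), ∀ ℓ : ℝ, 0 < ℓ → ∀ ξ : ℝ → ℝ³, (∀ t, ξ t 0 = 0 ∧ ξ t 1 = 0) →
    TendstoLocallyUniformly
        (fun (t : ℝ) (y : ℝ³) => ((T - t) ^ α) • u t (ξ t + (ℓ * Real.sqrt (ν * (T - t))) • y)) U
        (nhdsWithin T (Set.Iio T)) →
    HasNoSwirl U

end Summit.NavierStokesRegularity.NavierStokesRegularity.Cruxes.FrozenEddyCollapse.Ideator2

end
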